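import Summits.BirchSwinnertonDyer.Rank1Residual.P2.CMKolyvaginPointSystemOddTamagawaAtTwo
import Summits.BirchSwinnertonDyer.Rank1Residual.X11b.KolyvaginLeafInputsDischarged
import HarnessLib

/-!
# Route `CMKolyvaginAtInertTwo`, crux `CMKolyvaginExactAtInertTwo` (stmt-BirchSwinnertonDyer-24277):
# the LEVEL-ZERO CLASS THEOREM on H₂ for a prime Heegner field with EVERY Kolyvagin-side input a
# tree theorem — binders = the five BSD-side print facts + ONE named fact (Gross 3.7 (2))

Cell `bsd-print-cf2`, typer seat ty2 (the discharge interface). THEOREMS ONLY — no definition, no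
named fact, no instance, no `sorry`; no item is closed; BSD is not proved by this.

WHAT. `PointSystemOddTamagawa.bsdp_two_of_levelZero_primeHeegner_of_oddTamagawa_of_print` (this
seat, p640793) is the H₂ level-zero prime-Heegner class theorem with the Gross–Zagier III (3.1)
binder `hGZ` eliminated by the habitat's `Odd W.tamagawaProduct` and ONE displayed printed binder
left, `h53` (Gross 1991, Prop. 5.3: complex conjugation on `y_m` is `−w(E) ×` a
`Gal(K[m]/K)`-conjugate up to torsion). That binder is a THEOREM of the tree: x11b3's
`X11b.KolyvaginLeaves.h53_holds` (Prop. 5.3 at every Kolyvagin level, from Shimura reciprocity at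
conductor `m` — the Literature theorem `exists_mem_ringClassGal_map_pointGalHom_y_eq_of_heegnerHypothesis`
—, Atkin–Lehner `φ(w_N τ) = e φ(τ) + φ(0)` with `w(E) = −e`, and Manin–Drinfeld, all proved in the
tree). Feeding it:

* **`bsdp_two_of_levelZero_primeHeegner_of_prints`** — PRINTS {modularity `exists_isNewformOf`,
  Gross–Zagier at all levels, Gross–Zagier–Kolyvagin rank `≤ 1`,
  `Milne1972.bsdQuotient_baseChange_quadratic_anyModel`, `bsdTriple_of_hasCM_of_L_one_ne_zero`} →
  ∀ `W ∈ H₂` (`HasCM`, `CMInert W 2`, `ρ̄₂` onto, `r_an = 1`, `Odd ∏c`, globally minimal) →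
  ∀ `K` imaginary quadratic, `d_K = −q` (`q` prime), odd, `≠ −3`, Heegner for `N_E` →
  [`h372 : prop37_2_reductionCongruence_inert N_E W K`] → ∀ `Dt` (lattice clause) (`Odd Dt.c`) `β ι d₁`,
  `¬IsOfFinAddOrder d₁.derivedPoint` → (`¬∃Q, 2Q = P(1)`) → `BSDp W 2`.

This SUPERSEDES the sibling's §4 `bsdp_two_of_levelZero_primeHeegner_of_print`, which threads the
same binder through the Literature named fact `Darmon2004.prop311_complexConjugation` (Darmon 2004,
Prop. 3.11 for ALL Heegner points of conductor `n` — a statement the Kolyvagin roads do not need: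
they only meet the Galois orbit of Gross's `y(m)`, where `h53_holds` is unconditional). Same shape
as cmk2-p1 g9's `CMLevelZeroTwo.bsdp_two_of_levelZero_primeHeegner_of_print` (p640784) minus its
`hGZ31` binder.

HONEST FRAMING: a one-line COMPOSITION by name (ty2 g23/g24 Tamagawa road + x11b3's `h53_holds` +
cmk2-p1 g9's level-zero chain); no new mathematics; beyond print: NO for the inputs (the STATEMENT —
`p = 2`, CM, `2` inert — has no printed counterpart: Kolyvagin/Gross/McCallum take `p` odd; barrier
`CMRankOneAtNonsplitTwo` is the referee's call). What remains displayed: the five BSD-side print facts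
and Gross's Prop. 3.7 (2) (`prop37_2_reductionCongruence_inert`, named; Nekovář 2007 Prop. 4.9 is
its image-free print). BSD is not proved by this.

References: [GrossLMS1991] §1 (1.2), Prop. 2.1 with §10, §3 Prop. 3.7, §5 Props. 5.3, 5.4, §6
Prop. 6.2; [McCallumLMS1991] §1 Theorem, §4 Prop. 4.4, §5 Lemma 5.1; [Darmon2004] Thm. 3.7,
Prop. 3.11; [GrossZagier1986] Thm. I.6.3, V.§2; [BurungaleFlach2024] Thm. 1.1, Cor. 2;
[Milne1972ArithmeticAV] §1 Thm. 1; [Nekovar2007] Prop. 4.9.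
-/

set_option autoImplicit false

noncomputable section

open scoped Classical
open WeierstrassCurve Field NumberField IsDedekindDomain
open Literature.NumberTheory.EllipticCurves Literature.NumberTheory.GaloisRepresentations
open Literature.NumberTheory.EllipticCurves.ModularForms
open Literature.NumberTheory.EllipticCurves.Rank1Residual (CMInert)
open Summit.BirchSwinnertonDyer.Rank1Residual.X11b

namespace Summit.BirchSwinnertonDyer.Rank1Residual.P2.PointSystemOddTamagawa

/-- **THE LEVEL-ZERO CLASS THEOREM on H₂ for a prime Heegner field — inputs: five PRINT facts and the
named fact `prop37_2_reductionCongruence_inert N_E W K` only** (the sibling's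
`…_of_oddTamagawa_of_print` with `h53` := x11b3's theorem `KolyvaginLeaves.h53_holds rfl 2`).
`BSD₂(E)` for every `W ∈ H₂` (CM, `2` inert, `ρ̄₂` onto, `r_an = 1`, odd Tamagawa product,
globally minimal), every prime Heegner field `K = ℚ(√−q)` (odd `d_K ≠ −3`) and every frame with
lattice clause and odd Manin constant whose `y_K` has infinite order and is not `2`-divisible in
`E(K[1])`. [cite: GrossLMS1991, §1 (1.2), Prop. 2.1 with §10, Props. 3.7, 5.3, 5.4, 6.2]
[cite: McCallumLMS1991, §1 Theorem, §4 Prop. 4.4, §5 Lemma 5.1] [cite: Darmon2004, Thm. 3.7,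
Prop. 3.11] [cite: GrossZagier1986, Thm. I.6.3, V.§2 (pp. 310–312)] [cite: BurungaleFlach2024,
Thm. 1.1 and Cor. 2] [cite: Milne1972ArithmeticAV, §1 Thm. 1] -/
theorem bsdp_two_of_levelZero_primeHeegner_of_prints (hmod : exists_isNewformOf)
    (hGZ : ∀ (N : ℕ) [NeZero N] (W : WeierstrassCurve ℚ) (K : Type) [Field K] [NumberField K],
      gross_zagier N W K)
    (hGZK : rank_eq_analyticRank_of_analyticRank_le_one)
    (hMilne : Milne1972.bsdQuotient_baseChange_quadratic_anyModel)
    (hBF : bsdTriple_of_hasCM_of_L_one_ne_zero)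
    (W : WeierstrassCurve ℚ) [W.IsElliptic] [W.IsGloballyMinimal] [NeZero (W.conductorNorm ℤ)]
    (hCM : W.HasCM) (hin : CMInert W 2) (hsurj : W.HasSurjectiveModNGaloisRep (2 : ℤ))
    (hr : W.analyticRank = 1) (hT : Odd W.tamagawaProduct)
    (K : Type) [Field K] [NumberField K] (hK : IsImaginaryQuadratic K)
    (hodd : Odd (NumberField.discr K)) (h3 : NumberField.discr K ≠ -3)
    (hH : SatisfiesHeegnerHypothesis (W.conductorNorm ℤ) K)
    {q : ℕ} (hq : q.Prime) (hd : NumberField.discr K = -(q : ℤ))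
    (h372 : GrossLMS1991.prop37_2_reductionCongruence_inert (W.conductorNorm ℤ) W K)
    (Dt : ModularParametrizationData W (W.conductorNorm ℤ))
    (hopt : ∀ z ∈ Dt.L.lattice, ∃ w ∈ periodLattice Dt.f, z = (Dt.c : ℂ) * w) (hc : Odd Dt.c)
    (β : ℤ) (ι : K →+* ℂ) (d₁ : KolyvaginHeegnerData Dt β ι 1) (hy : ¬ IsOfFinAddOrder d₁.derivedPoint)
    (h2 : ¬ ∃ Q : (W.baseChange (ringClassField K ι 1)).toAffine.Point,
      (2 : ℤ) • Q = d₁.derivedPoint) :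
    BSDp W 2 :=
  bsdp_two_of_levelZero_primeHeegner_of_oddTamagawa_of_print hmod hGZ hGZK hMilne hBF W hCM hin hsurj hr
    hT K hK hodd h3 hH hq hd h372 (KolyvaginLeaves.h53_holds rfl 2) Dt hopt hc β ι d₁ hy h2

end Summit.BirchSwinnertonDyer.Rank1Residual.P2.PointSystemOddTamagawa

end
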